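import Mathlib
import HarnessLib
import Summits.HubbardSuperconductivity.HubbardSuperconductivity.Theorems.KLProgrammeKLRegimeTwoVolumeTowerStepCovSecFlowStep
import Summits.HubbardSuperconductivity.HubbardSuperconductivity.Theorems.KLProgrammeKLRegimeTwoVolumeTowerStepCovTelescopeTop
import Summits.HubbardSuperconductivity.HubbardSuperconductivity.Theorems.KLProgrammeKLRegimeTwoVolumeTowerStepCovData
import Summits.HubbardSuperconductivity.HubbardSuperconductivity.Theorems.KLProgrammeKLRegimeThinOverlapIncrementTelescopeRegime

/-!
# K3 VL child `KLRegimeVolumeLimitV17F2` (stmt-HubbardSuperconductivity-20440), located item #23 «W2-HALF-VL», COV/SEC shallow half, part 3S (ALL STEPS):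
# the SECTIONAL bundle `ScaleCovSecData` of the tower's step covariance `klStepCov V M β μ K_n k` AT THE TOP FLOW FRAME FOR EVERY STEP `k ≥ 1` —
# shallow steps by the frame telescope from the base `m₀ = 2k+6` (sectional pieces of part 3S (FLOW STEP), decaying like `4^{−i}`, ε-free), deep steps by
# the `_vol` door — in the `(1 + Λ_w·tnorm)` currency with ONE rate condition `Λ_w·4ⁿ ≤ ρc`, on any lattice `V` (`TowerCrossData.sec`)

Cell `gate-hubbard-kl`, seat p3 (g16), lead of #23.  The sectional twin of `scaleCovData_klStepCov_flow_all`: the telescope door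
`scaleCovSecData_klStepCov_flow_of_pieces` (p603893) from `K_{2k+6}` with the pieces `φ i = ψ i := 𝒦/(Λ_{k+2}²·4^{2k+6+i})` of `stepCovSec_pieces_flow`
(the rate condition `Λ_w·4^{m₀+i} ≤ Λ_w·4ⁿ ≤ ρc` holds on every piece; no weight-scale choice is needed in the sectional currency); the geometric sum is
`≤ (8/3)·𝒦/(Λ_{k+2}²·4^{2k+6}) ≤ 171·𝒦` (`Λ_{k+2}²·4^{2k+6} = 1/64`) — an absolute, ε-free addition to the deep door's `Ce`.

* `scaleCovSecData_mono` — `ScaleCovSecData` is monotone in its constant;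
* `scaleCovSecData_klStepCov_flow_shallow (dd)` — the shallow steps along the chain (`2k+6 ≤ m₀`, window at the base only);
* **`scaleCovSecData_klStepCov_flow_all (dd) (hdd : 10 ≤ dd)`** — `ScaleCovSecData (klStepCov V M β μ K_n k) Λ_w Ce` for EVERY `1 ≤ k`, `k + 2 ≤ n_β + 1`,
  `0 ≤ Λ_w ≤ Λ_{k+2}`, `Λ_w·4ⁿ ≤ ρc`, one absolute `Ce, ρc`.

Everything is proved; no definitions, no sorry.  Nothing asserts any stub, K3, VL or superconductivity. [cite: BenfattoGiulianiMastropietro2006, §2.8 (2.81), §3 (3.2)–(3.8)]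
-/

noncomputable section

namespace Summit.HubbardSuperconductivity.HubbardSuperconductivity.Theorems.TorusFourierL2

set_option linter.dupNamespace false -- summit = problem name (single-conjunct summit), D-0017

open Set Finset Literature.MathematicalPhysics.QuantumLattice Literature.MathematicalPhysics.QuantumLattice.BandSectorCounting
open Literature.MathematicalPhysics.QuantumLattice.FermiRG Literature.Probability.LatticeModels Literature.Analysis.SpecialFunctions
open Summit.HubbardSuperconductivity.HubbardSuperconductivity.Theorems.DispersionFlow
open Summit.HubbardSuperconductivity.HubbardSuperconductivity.Theorems.KLRegimeSplit
open Summit.HubbardSuperconductivity.HubbardSuperconductivity.Theorems.KLProgrammeLegKernels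
open Summit.HubbardSuperconductivity.HubbardSuperconductivity.Theorems.PerturbedFermiCurve
open Summit.HubbardSuperconductivity.HubbardSuperconductivity.Theorems.KLRegimeWick
open Summit.HubbardSuperconductivity.HubbardSuperconductivity.Theorems.EngineV8
open Summit.HubbardSuperconductivity.HubbardSuperconductivity.Theorems.TwoVolumeSource
open Summit.HubbardSuperconductivity.HubbardSuperconductivity.Theorems.TwoVolumeDefect
open scoped Real

open Classical

/-- **`ScaleCovSecData` is monotone in its constant.** [folklore] -/
theorem scaleCovSecData_mono {V M N : ℕ} [NeZero V] {C : Matrix (SpaceTimeIdx V M × SectorLeg N) (SpaceTimeIdx V M × SectorLeg N) ℂ}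
    {Λ eW eW' : ℝ} (h : ScaleCovSecData C Λ eW) (hle : eW ≤ eW') : ScaleCovSecData C Λ eW' where
  sec X t ℓ := (h.sec X t ℓ).trans hle

/-- `1 ≤ 64·(Λ_{k+2}²·4^{m₀})` for `2k + 6 ≤ m₀` (`Λ_{k+2} = 4^{−(k+2)}/32`). [folklore] -/
theorem one_le_klScale_sq_mul_pow {k m₀ : ℕ} (hkm : 2 * k + 6 ≤ m₀) : 1 ≤ 64 * (klScale klE0 (k + 2) ^ 2 * (4 : ℝ) ^ m₀) := by
  have hΛ : klScale klE0 (k + 2) = (1 / 32) * ((4 : ℝ) ^ (k + 2))⁻¹ := by rw [klScale, klE0]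
  have hpow : (4 : ℝ) ^ (2 * k + 6) ≤ (4 : ℝ) ^ m₀ := pow_le_pow_right₀ (by norm_num) hkm
  have e : (4 : ℝ) ^ (2 * k + 6) = ((4 : ℝ) ^ (k + 2)) ^ 2 * 16 := by
    rw [show (16 : ℝ) = (4 : ℝ) ^ 2 by norm_num, ← pow_mul, ← pow_add]; congr 1; omega
  have h0 : (0 : ℝ) < (4 : ℝ) ^ (k + 2) := by positivity
  rw [hΛ]
  rw [e] at hpow
  have h1 : ((1 / 32) * ((4 : ℝ) ^ (k + 2))⁻¹) ^ 2 * (4 : ℝ) ^ m₀ ≥ ((1 / 32) * ((4 : ℝ) ^ (k + 2))⁻¹) ^ 2 * (((4 : ℝ) ^ (k + 2)) ^ 2 * 16) :=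
    mul_le_mul_of_nonneg_left hpow (by positivity)
  have h2 : ((1 / 32) * ((4 : ℝ) ^ (k + 2))⁻¹) ^ 2 * (((4 : ℝ) ^ (k + 2)) ^ 2 * 16) = 1 / 64 := by field_simp; norm_num
  rw [h2] at h1
  linarith

set_option maxHeartbeats 3200000 in -- long binder lists of the door and the pieces
/-- **`ScaleCovSecData` of the tower's step covariance at the end of the flow chain for the SHALLOW steps, by name**: base `2k+6 ≤ m₀` (window at the
base only), sectional pieces of `stepCovSec_pieces_flow`, `Λ_w·4^{m₀+d} ≤ ρc`. [cite: BenfattoGiulianiMastropietro2006, §2.8 (2.81), §3 (3.2)–(3.8)] -/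
theorem scaleCovSecData_klStepCov_flow_shallow (dd : ℕ) :
    ∃ Ce ρc : ℝ, 0 < Ce ∧ 0 < ρc ∧
      ∀ (G : GeoConsts) (P : SplitConsts) (R : RenConsts) (Q : EngConsts) (cc : ℝ), R.WF2 → 0 < cc → cc ≤ EngineV8.klEngC₃6 P R →
      ∀ μ ∈ klWindowC, ∀ U : ℝ, 0 < U → U ≤ min (EngineV8.klEngU₀3 P R cc) (1 / (R.Gfr 3 + 1)) →
      ∀ β : ℝ, klBetaMin ≤ β → β ≤ Real.exp (cc / U ^ 2) →
      ∀ (L M : ℕ) [NeZero L] [NeZero M], EngineV8.klEngL₃ β U ≤ L → EngineV8.klEngM₃ β U L ≤ M →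
      ∀ m₀ d : ℕ, 1 ≤ m₀ → m₀ + d ≤ nScales β + 1 → HistP klPredsV17F2 L M G P Q R β U μ 0 (m₀ + d) →
        ∀ (V : ℕ) [NeZero V], EngineV8.klEngL₃ β U ≤ V →
        ∀ k : ℕ, 1 ≤ k → k + 2 ≤ nScales β + 1 → 2 * k + 6 ≤ m₀ → (4 : ℝ) ^ (m₀ + 2) * U ≤ (4 : ℝ) ^ (2 * k + dd) →
        ∀ Λw : ℝ, 0 ≤ Λw → Λw ≤ klScale klE0 (k + 2) → Λw * (4 : ℝ) ^ (m₀ + d) ≤ ρc →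
          ScaleCovSecData (klStepCov V M β μ (klFlowFrameU L M β U μ (m₀ + d)) k) Λw Ce := by
  obtain ⟨Ce₀, hCe₀, hdoor⟩ := scaleCovSecData_klStepCov_flow_of_pieces dd
  obtain ⟨𝒦, ρw, h𝒦, hρw, hρw1, hpieces⟩ := stepCovSec_pieces_flow
  refine ⟨Ce₀ + 171 * 𝒦, ρw, by positivity, hρw, ?_⟩
  intro G P R Q cc hR2 hcc hcc6 μ hμ U hU hUle β hβmin hβc L M _ _ hL3 hM3 m₀ d hm1 hN hhist V _ hV3 k hk hkN hkm hwin Λw hΛw0 hΛwle hΛwρ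
  have hΛs : 0 < klScale klE0 (k + 2) := klth_klScale_pos _
  have hx0 : (0 : ℝ) < (4 : ℝ) ^ (m₀ + d) := by positivity
  -- the rate condition on every piece
  have hrate : ∀ i < d, Λw * (4 : ℝ) ^ (m₀ + i) ≤ ρw := fun i hi =>
    (mul_le_mul_of_nonneg_left (pow_le_pow_right₀ (by norm_num) (by omega)) hΛw0).trans hΛwρ
  have hPc := fun i (hi : i < d) => hpieces G P R Q cc hR2 hcc hcc6 μ hμ U hU hUle β hβmin hβc L M hL3 hM3 (m₀ + d) hN hhist V hV3 k hk hkN (m₀ + i)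
    (by omega) (by omega) Λw hΛw0 (hrate i hi)
  set φ : ℕ → ℝ := fun i => 𝒦 / (klScale klE0 (k + 2) ^ 2 * (4 : ℝ) ^ (m₀ + i)) with hφ
  have hd := hdoor G P R Q cc hR2 hcc hcc6 μ hμ U hU hUle β hβmin hβc L M hL3 hM3 m₀ d hm1 hN hhist V hV3 k hk hkN hwin Λw hΛw0 hΛwle φ φ
    (fun i hi X t ℓ => (hPc i hi).1 X t ℓ) (fun i hi X t ℓ => (hPc i hi).2 X t ℓ)
  refine scaleCovSecData_mono hd ?_
  -- the geometric sum `Σ_{i<d} 2φ i ≤ 171·𝒦`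
  have e : ∀ i, φ i + φ i = (2 * 𝒦 / klScale klE0 (k + 2) ^ 2) / (4 : ℝ) ^ (m₀ + i) := fun i => by rw [hφ]; field_simp; ring
  simp_rw [e]
  refine (add_le_add le_rfl (sum_div_four_pow_le (c := 2 * 𝒦 / klScale klE0 (k + 2) ^ 2) (by positivity) m₀ d)).trans ?_
  have h64 := one_le_klScale_sq_mul_pow hkm
  refine add_le_add le_rfl ?_
  rw [show 4 / 3 * (2 * 𝒦 / klScale klE0 (k + 2) ^ 2 / (4 : ℝ) ^ m₀) = (8 / 3 * 𝒦) * (1 / (klScale klE0 (k + 2) ^ 2 * (4 : ℝ) ^ m₀)) by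
    field_simp; ring]
  have h1 : 1 / (klScale klE0 (k + 2) ^ 2 * (4 : ℝ) ^ m₀) ≤ 64 := by
    rw [div_le_iff₀ (by positivity)]; linarith
  nlinarith only [h1, h𝒦]

set_option maxHeartbeats 3200000 in -- long binder lists of the two doors
/-- **`ScaleCovSecData` of the tower's step covariance at the top flow frame for ALL steps** (see the module docstring).
[cite: BenfattoGiulianiMastropietro2006, §2.8 (2.81), §3 (3.2)–(3.8)] -/
theorem scaleCovSecData_klStepCov_flow_all (dd : ℕ) (hdd : 10 ≤ dd) :
    ∃ Ce ρc : ℝ, 0 < Ce ∧ 0 < ρc ∧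
      ∀ (G : GeoConsts) (P : SplitConsts) (R : RenConsts) (Q : EngConsts) (cc : ℝ), R.WF2 → 0 < cc → cc ≤ EngineV8.klEngC₃6 P R →
      ∀ μ ∈ klWindowC, ∀ U : ℝ, 0 < U → U ≤ min (EngineV8.klEngU₀3 P R cc) (1 / (R.Gfr 3 + 1)) →
      ∀ β : ℝ, klBetaMin ≤ β → β ≤ Real.exp (cc / U ^ 2) →
      ∀ (L M : ℕ) [NeZero L] [NeZero M], EngineV8.klEngL₃ β U ≤ L → EngineV8.klEngM₃ β U L ≤ M →
      ∀ n : ℕ, 1 ≤ n → n ≤ nScales β + 1 → HistP klPredsV17F2 L M G P Q R β U μ 0 n →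
        ∀ (V : ℕ) [NeZero V], EngineV8.klEngL₃ β U ≤ V →
        ∀ k : ℕ, 1 ≤ k → k + 2 ≤ nScales β + 1 →
        ∀ Λw : ℝ, 0 ≤ Λw → Λw ≤ klScale klE0 (k + 2) → Λw * (4 : ℝ) ^ n ≤ ρc →
          ScaleCovSecData (klStepCov V M β μ (klFlowFrameU L M β U μ n) k) Λw Ce := by
  obtain ⟨Ce₁, hCe₁, hdeep⟩ := scaleCovSecData_klStepCov_klEng_flow_deep_vol dd
  obtain ⟨Ce₂, ρc, hCe₂, hρc, hshallow⟩ := scaleCovSecData_klStepCov_flow_shallow dd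
  refine ⟨max Ce₁ Ce₂, ρc, lt_max_of_lt_left hCe₁, hρc, ?_⟩
  intro G P R Q cc hR2 hcc hcc6 μ hμ U hU hUle β hβmin hβc L M _ _ hL3 hM3 n hn1 hnN hhist V _ hV3 k hk hkN Λw hΛw0 hΛwle hΛwρ
  have hfr : FrameOK R U (nScales β) μ (klFlowFrameU L M β U μ n) := frameOK_klFlowFrameU_of_histP_le hR2 hn1 le_rfl hnN hhist
  have hU1 : U ≤ 1 := ((hUle.trans (min_le_left _ _)).trans (EngineV8.klEngU₀3_le_two_pow P R cc)).trans (by norm_num)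
  by_cases hwin : (4 : ℝ) ^ (n + 2) * U ≤ (4 : ℝ) ^ (2 * k + dd)
  · exact scaleCovSecData_mono (hdeep G P R Q cc hR2 hcc hcc6 μ hμ U hU hUle β hβmin hβc L M hL3 hM3 n hn1 hnN hhist hfr V hV3 k hk hkN hwin Λw hΛw0 hΛwle)
      (le_max_left _ _)
  · have hm₀n : 2 * k + 6 ≤ n := by
      by_contra hlt
      apply hwin
      have hle : n + 2 ≤ 2 * k + 8 := by omega
      calc (4 : ℝ) ^ (n + 2) * U ≤ (4 : ℝ) ^ (n + 2) * 1 := mul_le_mul_of_nonneg_left hU1 (by positivity)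
        _ ≤ (4 : ℝ) ^ (2 * k + 8) := by rw [mul_one]; exact pow_le_pow_right₀ (by norm_num) hle
        _ ≤ (4 : ℝ) ^ (2 * k + dd) := pow_le_pow_right₀ (by norm_num) (by omega)
    obtain ⟨d, rfl⟩ : ∃ d, n = 2 * k + 6 + d := ⟨n - (2 * k + 6), by omega⟩
    have hbase : (4 : ℝ) ^ (2 * k + 6 + 2) * U ≤ (4 : ℝ) ^ (2 * k + dd) :=
      calc (4 : ℝ) ^ (2 * k + 6 + 2) * U ≤ (4 : ℝ) ^ (2 * k + 6 + 2) * 1 := mul_le_mul_of_nonneg_left hU1 (by positivity)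
        _ ≤ (4 : ℝ) ^ (2 * k + dd) := by rw [mul_one]; exact pow_le_pow_right₀ (by norm_num) (by omega)
    exact scaleCovSecData_mono (hshallow G P R Q cc hR2 hcc hcc6 μ hμ U hU hUle β hβmin hβc L M hL3 hM3 (2 * k + 6) d (by omega) hnN hhist V hV3 k hk hkN
      le_rfl hbase Λw hΛw0 hΛwle hΛwρ) (le_max_right _ _)

end Summit.HubbardSuperconductivity.HubbardSuperconductivity.Theorems.TorusFourierL2

end
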